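import Summits.AtomisticToContinuum.Crystallization.Theorems.OverbindingBudgetAffineRunCutFlat

/-!
# NODE g99 «WildCut» (lens-4, minimal counterexample / extremal reduction) — part A: the typed partition of the WILD residual and its PROVED cell

TARGET.  The residual of record of `stmt-AtomisticToContinuum-31280` on the (2c) line (census v55, Table R55): **RW** = `WildRun` /
`WildRunWide` / «WildRunWide(30)», i.e. `TameBalancedWildRunGap 64 ρ₁ (1/10⁴) (1/1000) (3/50) (1/450) 12 2` at the wild radius `ρ₁ ∈ {12, 24, 30}`:
`c > 0` per WILD run-interior interface cubic site — a cubic-lettered site `j` whose five layers `j−2 … j+2` are cubic, lying in the `12·nn`-ball of a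
`(64, 3/50)`-deep site that also sees a hexagonal letter, and whose `ρ₁·nn`-ball is NOT `(1/10⁴, 1/1000)`-affinely registered (rough beyond `10⁻⁴·nn`
or distorted beyond `10⁻³` somewhere in it) — against `C·(#¬64-deep + #off + N^{2/3} + gains)`.  Booked IDEA-NEEDED since g78 («B_aff-type»).

THE EXTREMAL QUESTION (lens 4).  Let `y` be a counterexample to RW with the fewest wild sites per unit excess.  WHERE can a wild site of `y` sit, and in
WHICH MECHANICAL STATE?  Four observations, each a LOCAL predicate already on the tree, cut the wild population LOSSLESSLY:

(E1) NOT in the shadow of a defect: a wild site that is not `L`-deep lies within `L·nn` of an unregistered site, and in-window sites are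
  `σ₁`-separated — the `L`-shadow is count-charged to the rebate (`notDeepCount_depth_le` BY NAME, g74's packing half).  So the minimal counterexample is
  DEFECT-FREE out to every fixed radius `L`: vacancies, dislocation cores, grain boundaries, cracks and surfaces never produce wild sites that matter.
(E2) NOT collapsed and NOT compressed-while-rigid: a wild site with `nn < 17/50`, or with a `(12, 1/10⁴, 1/1000)`-affinely deep ball and `nn < 17/20`,
  is — if `64`-deep and in-window — a PRICED site of the economical two-class law «KD♭» of g79 (`Priced`, first class letter- and chart-free, second
  class at radius `12`), and that law is ON TREE: `nearFieldSlackFirstAt_record`, `nearFieldSlackMinSecond_record`, `farFieldControlAt_min`,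
  `compressedSiteSlackAt_of_near_far`, `compressedDeepAt_of_siteSlackAt` BY NAME.  The cell «AbsorbedWild» is therefore PROVED here (§3), at every `ρ₁`.
(E3) The remaining wild sites split by the TOLERANCE LADDER of the affine registration, measured where the engines need it: at the wild radius `ρ₁` for
  the registry swap (its far field wants charted partners out to `22·nn`), at radius `12` for the sitewise laws:
  * «MildShear» — the `ρ₁·nn`-ball IS `(1/10⁴, θ₁)`-affinely registered (smooth, sheared by at most `θ₁`; by wildness, beyond `10⁻³` somewhere): the
    class of the SAME registry swap on the strain box `dist(F, SO(3)) ≤ θ₁` — every `(1/10⁴, θ₁)`-smooth run interior is a rigid run interior of the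
    parametric competitor `TameStackSwapGainFlat 64 ρ₁ (1/10⁴) θ₁ …` (tolerance `θ₀ := θ₁`; NO new statement shape).  Its gain `2|J₂(a)| = 1.44·10⁻⁴` at
    `a⋆` is eroded only by the twin-variant anisotropy `λ_aniso·θ₁²` (77T: `≲ 2·10⁻⁵` at `10⁻³`, i.e. `λ_aniso ≈ 20` pessimistic; cubic-anisotropy
    estimate `λ_aniso ≈ 6`), so the swap survives up to `θ₁ ≈ 2.7·10⁻³ … 4.9·10⁻³`; the node's instance takes `θ₁ = 1/400`.  INSTRUMENTABLE (census ask
    «SHEARBOX»: the (2c) column-gain tables re-run on the strain box, memo §3).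
  * «HaloWild» — not `θ₁`-mild out to `ρ₁`, but the `12·nn`-ball is `(1/10⁴, 1/1000)`-rigid and `nn ≥ 17/20`: a rigid run interior of the radius-`12`
    swap (`RigidRun` ⊇ halo; the ρ₁ = 12 «β fallback» of g85), wild only because rough or strained matter sits `12 … ρ₁` spacings away.
    ATTACKABLE-L · INSTRUMENTABLE (does the 27V far ledger bound the swap's exterior beyond `12·nn` from `3/50`-registration alone? memo §4).  EMPTY at `ρ₁ = 12`.
  * «StrainCore» — the `12·nn`-ball is `(1/10⁴, 1/25)`-smooth but NOT `(1/10⁴, 1/1000)`-rigid (and the `ρ₁`-ball not `θ₁`-mild): smooth, strongly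
    strained two-letter matter right at the run interior.  IDEA-NEEDED (the sitewise strain cushion `½λ_min θ²` beats the linear roughness junk
    `≈ 1.5·10⁻⁴` and the tail only from `θ ≳ 10⁻²`; the band `(θ₁, 10⁻²)` has no engine; memo §5).
  * «RoughCore» — the `12·nn`-ball is not even `(1/10⁴, 1/25)`-affinely registered: genuinely ROUGH deep two-letter matter at the run interior.
    IDEA-NEEDED · INSTRUMENTABLE (the skeleton-equilibrium engine of the slot-3 cone needs its harmonic margin on POLYTYPE windows —
    «PolytypeMarginStability», the two-letter twin of `PureMarginStabilityAt`; memo §6).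
(E4) Every cell is WEAKER than RW (it prices a subset of RW's sites against RW's rebate: `censusW_mono` BY NAME), and RW is the GLUED SUM of its cells
  (`censusW_glue` BY NAME + (E1)); the cover needs no monotonicity, the second-level cover (wild at tolerance `θ₁`) needs `1/1000 ≤ θ₁`
  (`affDeepReg_mono_theta` BY NAME).

THE CUT (part B `…AffineWildCut`, all seams PROVED, 0 sorry; here: definitions, counting, and the PROVED cell):

  W(ρ₁, 10⁻³) ⟺ MildShear ∧ HaloWild ∧ StrainCore ∧ RoughCore            (any depth `L ≥ 0`; «AbsorbedWild» PROVED and dropped)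
  W(ρ₁, θ₁)  ⟺ HaloWild ∧ StrainCore ∧ RoughCore                          (`1/1000 ≤ θ₁`; the wild leaf of the swap AT TOLERANCE θ₁)
  RunInterior ⟸ SW♭(ρ₁, θ₁) ∧ RO(ρ₁, θ₁) ∧ HaloWild ∧ StrainCore ∧ RoughCore,   RO(ρ₁, θ₁) ⟸ RO(ρ₁, 10⁻³) [PROVED, ρ₁ ≥ 12] ∧ CompressedMild
  ∴ InterfaceDominance ⟸ SW♭(ρ₁, θ₁) ∧ CompressedMild(ρ₁, θ₁) ∧ HaloWild ∧ StrainCore ∧ RoughCore ∧ ThinFault   (ρ₁ ≥ 12, θ₁ ≥ 10⁻³, L ≥ 0).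

Literals fixed inside the cells (forced by the tree engines): `(ρ, ε, g, r, rh) = (64, 3/50, 1/450, 12, 2)`, `(η, θ₀) = (1/10⁴, 1/1000)`, KD♭'s
`(12, 17/50, 17/20)`, ladder top `1/25`.  Parameters: wild radius `ρ₁`, depth `L`, shear tolerance `θ₁`, window `[σ₁, σ₂]`.
No `local notation`, no instances.  Memo `HOME/decomp-a2c-lens-4/g99/memo/NODE-g99-WildCut.md`; probes `HOME/…/g99/bc/`.
-/

namespace Summit.AtomisticToContinuum.Crystallization.Theorems.OverbindingBudgetAffineWildCut

open scoped BigOperators Classical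
open Literature.MathematicalPhysics.StatisticalMechanics
open Literature.Geometry.DiscreteGeometry (IsChargeFree nearestDist nearestDist_nonneg nearestDist_le_dist)
open Summit.AtomisticToContinuum.Crystallization.Theorems.OverbindingBudgetMisfitRegistration (Framed Reg DeepReg)
open Summit.AtomisticToContinuum.Crystallization.Theorems.OverbindingBudgetMisfitWindowStatements (InWindow offCount)
open Summit.AtomisticToContinuum.Crystallization.Theorems.OverbindingBudgetBalancedCensusStatements
open Summit.AtomisticToContinuum.Crystallization.Theorems.OverbindingBudgetAffineLadder
open Summit.AtomisticToContinuum.Crystallization.Theorems.OverbindingBudgetAffineMesoCut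
open Summit.AtomisticToContinuum.Crystallization.Theorems.OverbindingBudgetAffinePhaseCut
open Summit.AtomisticToContinuum.Crystallization.Theorems.OverbindingBudgetAffineCushionCut
open Summit.AtomisticToContinuum.Crystallization.Theorems.OverbindingBudgetAffineTwinCut
open Summit.AtomisticToContinuum.Crystallization.Theorems.OverbindingBudgetAffineRunCut
open Summit.AtomisticToContinuum.Crystallization.Theorems.OverbindingBudgetAffineCompressedCut
open Summit.AtomisticToContinuum.Crystallization.Theorems.OverbindingBudgetAffineCompressedCutInner (nearFieldSlackMinSecond_record)
open Summit.AtomisticToContinuum.Crystallization.Theorems.OverbindingBudgetAffineRunCutFlat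

variable {N : ℕ}

/-! ## §1  Two counting rules for subtypes of `Fin N` (formal bookkeeping) -/

/-- A pointwise implication bounds a subtype count by another. [formal bookkeeping] -/
theorem natCard_le_of_imp {P Q : Fin N → Prop} (h : ∀ j, P j → Q j) : Nat.card {j // P j} ≤ Nat.card {j // Q j} := by
  simp only [Nat.card_eq_fintype_card, Fintype.card_subtype]
  apply Finset.card_le_card
  intro j hj
  rw [Finset.mem_filter] at hj ⊢
  exact ⟨hj.1, h j hj.2⟩

/-- A pointwise case split bounds a subtype count by the sum of two counts. [formal bookkeeping] -/
theorem natCard_le_add_of_imp {P Q R : Fin N → Prop} (h : ∀ j, P j → Q j ∨ R j) :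
    Nat.card {j // P j} ≤ Nat.card {j // Q j} + Nat.card {j // R j} := by
  simp only [Nat.card_eq_fintype_card, Fintype.card_subtype]
  calc (Finset.univ.filter P).card ≤ ((Finset.univ.filter Q) ∪ (Finset.univ.filter R)).card := by
        apply Finset.card_le_card
        intro j hj
        rw [Finset.mem_filter] at hj
        rw [Finset.mem_union, Finset.mem_filter, Finset.mem_filter]
        rcases h j hj.2 with hq | hr
        · exact Or.inl ⟨hj.1, hq⟩
        · exact Or.inr ⟨hj.1, hr⟩
    _ ≤ _ := Finset.card_union_le _ _

/-! ## §2  The wild predicate and its five cells -/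

/-- `WildSite ρ₁ y j` — VERBATIM the predicate counted by `wildRunCount 64 ρ₁ (1/10⁴) (1/1000) (3/50) (1/450) 12 2`: a run-interior interface cubic site
(`CFramed`, anchored within `12·nn` of a `64`-deep `HNear 12` site, no hexagonal letter within `2·nn`) whose `ρ₁·nn`-ball is not `(1/10⁴, 1/1000)`-affinely
registered. -/
def WildSite (ρ₁ : ℝ) (y : Fin N → EuclideanSpace ℝ (Fin 3)) (j : Fin N) : Prop :=
  ((CFramed (3 / 50) (1 / 450) y j ∧ ∃ i : Fin N, DeepReg 64 (3 / 50) (1 / 450) y i ∧ dist (y j) (y i) ≤ 12 * nearestDist y i ∧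
      HNear 12 (3 / 50) (1 / 450) y i) ∧ ¬ HNear 2 (3 / 50) (1 / 450) y j) ∧ ¬ AffDeepReg ρ₁ (1 / 10 ^ 4) (1 / 1000) (1 / 450) y j

/-- `wildRunCount` at the literals of record counts `WildSite`. [formal bookkeeping] -/
theorem wildRunCount_eq (ρ₁ : ℝ) (y : Fin N → EuclideanSpace ℝ (Fin 3)) :
    wildRunCount 64 ρ₁ (1 / 10 ^ 4) (1 / 1000) (3 / 50) (1 / 450) 12 2 y = Nat.card {j // WildSite ρ₁ y j} := rfl

/-- `Absorbable y j` — VERBATIM the class disjunction of g79's `Priced 64 12 (1/10⁴) (1/1000) (17/50) (17/20) (3/50) (1/450)`: collapsed below `17/50`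
(any letter, any chart), or `(12, 1/10⁴, 1/1000)`-affinely deep and compressed below `17/20`. -/
def Absorbable (y : Fin N → EuclideanSpace ℝ (Fin 3)) (j : Fin N) : Prop :=
  nearestDist y j < 17 / 50 ∨ (AffDeepReg 12 (1 / 10 ^ 4) (1 / 1000) (1 / 450) y j ∧ nearestDist y j < 17 / 20)

/-- Cell (E2) «absorbed»: wild AND absorbable — PROVED below (§3). -/
noncomputable def absorbedWildCount (ρ₁ : ℝ) (y : Fin N → EuclideanSpace ℝ (Fin 3)) : ℕ :=
  Nat.card {j // WildSite ρ₁ y j ∧ Absorbable y j}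

/-- Cell «MildShear»: wild, `L`-deep, not absorbable, and the `ρ₁·nn`-ball IS `(1/10⁴, θ₁)`-affinely registered — smooth, sheared by `≤ θ₁` (and, being
wild, by `> 10⁻³` somewhere): the class of the registry swap at tolerance `θ₁`. -/
noncomputable def mildShearCount (ρ₁ L θ₁ : ℝ) (y : Fin N → EuclideanSpace ℝ (Fin 3)) : ℕ :=
  Nat.card {j // WildSite ρ₁ y j ∧ (DeepReg L (3 / 50) (1 / 450) y j ∧ ¬ Absorbable y j) ∧ AffDeepReg ρ₁ (1 / 10 ^ 4) θ₁ (1 / 450) y j}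

/-- Cell «HaloWild»: wild, `L`-deep, not absorbable, NOT `θ₁`-mild out to `ρ₁`, but `(12, 1/10⁴, 1/1000)`-affinely deep (hence `nn ≥ 17/20`): a rigid run
interior of the radius-`12` swap whose wildness is witnessed only `12 … ρ₁` spacings away.  Empty at `ρ₁ = 12`. -/
noncomputable def haloWildCount (ρ₁ L θ₁ : ℝ) (y : Fin N → EuclideanSpace ℝ (Fin 3)) : ℕ :=
  Nat.card {j // WildSite ρ₁ y j ∧ (DeepReg L (3 / 50) (1 / 450) y j ∧ ¬ Absorbable y j) ∧
    ¬ AffDeepReg ρ₁ (1 / 10 ^ 4) θ₁ (1 / 450) y j ∧ AffDeepReg 12 (1 / 10 ^ 4) (1 / 1000) (1 / 450) y j}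

/-- Cell «StrainCore»: wild, `L`-deep, not absorbable, not `θ₁`-mild out to `ρ₁`, the `12·nn`-ball NOT `(1/10⁴, 1/1000)`-rigid but `(1/10⁴, 1/25)`-smooth:
smooth, strongly strained two-letter matter at the run interior. -/
noncomputable def strainCoreCount (ρ₁ L θ₁ : ℝ) (y : Fin N → EuclideanSpace ℝ (Fin 3)) : ℕ :=
  Nat.card {j // WildSite ρ₁ y j ∧ (DeepReg L (3 / 50) (1 / 450) y j ∧ ¬ Absorbable y j) ∧
    ¬ AffDeepReg ρ₁ (1 / 10 ^ 4) θ₁ (1 / 450) y j ∧ ¬ AffDeepReg 12 (1 / 10 ^ 4) (1 / 1000) (1 / 450) y j ∧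
    AffDeepReg 12 (1 / 10 ^ 4) (1 / 25) (1 / 450) y j}

/-- Cell «RoughCore»: wild, `L`-deep, not absorbable, not `θ₁`-mild out to `ρ₁`, and the `12·nn`-ball not even `(1/10⁴, 1/25)`-affinely registered:
genuinely rough deep two-letter matter at the run interior (the B_aff-type core). -/
noncomputable def roughCoreCount (ρ₁ L θ₁ : ℝ) (y : Fin N → EuclideanSpace ℝ (Fin 3)) : ℕ :=
  Nat.card {j // WildSite ρ₁ y j ∧ (DeepReg L (3 / 50) (1 / 450) y j ∧ ¬ Absorbable y j) ∧
    ¬ AffDeepReg ρ₁ (1 / 10 ^ 4) θ₁ (1 / 450) y j ∧ ¬ AffDeepReg 12 (1 / 10 ^ 4) (1 / 25) (1 / 450) y j}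

/-- The census of a cell: `CensusW` of its count against RW's own rebate `#{not (64, 3/50, 1/450)-deep}` on the window `[σ₁, σ₂]`. -/
def AbsorbedWildW (ρ₁ σ₁ σ₂ : ℝ) : Prop :=
  CensusW (fun y => absorbedWildCount ρ₁ y) (fun y => notDeepCount 64 (3 / 50) (1 / 450) y) σ₁ σ₂

/-- «MildShear_W» (one window). [this file · kind: statement · WEAKER than RW_W · INSTRUMENTABLE (registry swap on the strain box `θ ≤ θ₁`)] -/
def MildShearW (ρ₁ L θ₁ σ₁ σ₂ : ℝ) : Prop :=
  CensusW (fun y => mildShearCount ρ₁ L θ₁ y) (fun y => notDeepCount 64 (3 / 50) (1 / 450) y) σ₁ σ₂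

/-- «HaloWild_W» (one window). [this file · kind: statement · WEAKER than RW_W and than RigidRun_W(12) · ATTACKABLE-L · INSTRUMENTABLE] -/
def HaloWildW (ρ₁ L θ₁ σ₁ σ₂ : ℝ) : Prop :=
  CensusW (fun y => haloWildCount ρ₁ L θ₁ y) (fun y => notDeepCount 64 (3 / 50) (1 / 450) y) σ₁ σ₂

/-- «StrainCore_W» (one window). [this file · kind: statement · WEAKER than RW_W · IDEA-NEEDED] -/
def StrainCoreW (ρ₁ L θ₁ σ₁ σ₂ : ℝ) : Prop :=
  CensusW (fun y => strainCoreCount ρ₁ L θ₁ y) (fun y => notDeepCount 64 (3 / 50) (1 / 450) y) σ₁ σ₂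

/-- «RoughCore_W» (one window). [this file · kind: statement · WEAKER than RW_W · IDEA-NEEDED · INSTRUMENTABLE («PolytypeMarginStability»)] -/
def RoughCoreW (ρ₁ L θ₁ σ₁ σ₂ : ℝ) : Prop :=
  CensusW (fun y => roughCoreCount ρ₁ L θ₁ y) (fun y => notDeepCount 64 (3 / 50) (1 / 450) y) σ₁ σ₂

/-- «MildShear» (tame: every window `[δ, 2]`, `0 < δ ≤ 2`). -/
def MildShear (ρ₁ L θ₁ : ℝ) : Prop :=
  ∀ δ : ℝ, 0 < δ → δ ≤ 2 → MildShearW ρ₁ L θ₁ δ 2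

/-- «HaloWild» (tame). -/
def HaloWild (ρ₁ L θ₁ : ℝ) : Prop :=
  ∀ δ : ℝ, 0 < δ → δ ≤ 2 → HaloWildW ρ₁ L θ₁ δ 2

/-- «StrainCore» (tame). -/
def StrainCore (ρ₁ L θ₁ : ℝ) : Prop :=
  ∀ δ : ℝ, 0 < δ → δ ≤ 2 → StrainCoreW ρ₁ L θ₁ δ 2

/-- «RoughCore» (tame). -/
def RoughCore (ρ₁ L θ₁ : ℝ) : Prop :=
  ∀ δ : ℝ, 0 < δ → δ ≤ 2 → RoughCoreW ρ₁ L θ₁ δ 2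

/-! ## §3  PROVED: the absorbed cell is paid by the economical two-class law ON TREE -/

/- `compressedDeepAt_min` (KD♭ at every window) is the TREE lemma `…AffineRunCutFlat.compressedDeepAt_min`, used BY NAME below (critic lane ed1). -/

/-- Counting: `#absorbedWild ≤ #priced + #{not 64-deep} + #off` — an absorbable wild site that is `64`-deep and in-window is `Priced`. [this file] -/
theorem absorbedWildCount_le_priced_add (ρ₁ δ : ℝ) (y : Fin N → EuclideanSpace ℝ (Fin 3)) :
    absorbedWildCount ρ₁ y ≤ pricedCount 64 12 (1 / 10 ^ 4) (1 / 1000) (17 / 50) (17 / 20) (3 / 50) (1 / 450) δ y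
      + notDeepCount 64 (3 / 50) (1 / 450) y + offCount δ 2 y := by
  have h1 : absorbedWildCount ρ₁ y ≤
      Nat.card {j : Fin N // Priced 64 12 (1 / 10 ^ 4) (1 / 1000) (17 / 50) (17 / 20) (3 / 50) (1 / 450) δ y j ∨
          ¬ DeepReg 64 (3 / 50) (1 / 450) y j} + Nat.card {j : Fin N // ¬ InWindow δ 2 y j} :=
    natCard_le_add_of_imp fun j hj => by
      by_cases hW : InWindow δ 2 y j
      · by_cases hD : DeepReg 64 (3 / 50) (1 / 450) y j
        · exact Or.inl (Or.inl ⟨⟨hD, hW⟩, hj.2⟩)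
        · exact Or.inl (Or.inr hD)
      · exact Or.inr hW
  have h2 : Nat.card {j : Fin N // Priced 64 12 (1 / 10 ^ 4) (1 / 1000) (17 / 50) (17 / 20) (3 / 50) (1 / 450) δ y j ∨
        ¬ DeepReg 64 (3 / 50) (1 / 450) y j} ≤
      pricedCount 64 12 (1 / 10 ^ 4) (1 / 1000) (17 / 50) (17 / 20) (3 / 50) (1 / 450) δ y + notDeepCount 64 (3 / 50) (1 / 450) y :=
    natCard_le_add_of_imp fun j hj => hj
  have h3 : Nat.card {j : Fin N // ¬ InWindow δ 2 y j} = offCount δ 2 y := rfl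
  omega

/-- **PROVED CELL: «AbsorbedWild_W» holds at every `ρ₁` and every window `[δ, 2]`, `0 < δ ≤ 2`** (census domination `censusW_of_le_add` BY NAME). [this file] -/
theorem absorbedWildW_record (ρ₁ : ℝ) {δ : ℝ} (hδ : 0 < δ) (hδ2 : δ ≤ 2) : AbsorbedWildW ρ₁ δ 2 := by
  have h : CensusW (fun y => pricedCount 64 12 (1 / 10 ^ 4) (1 / 1000) (17 / 50) (17 / 20) (3 / 50) (1 / 450) δ y)
      (fun y => notDeepCount 64 (3 / 50) (1 / 450) y) δ 2 := compressedDeepAt_min hδ hδ2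
  exact censusW_of_le_add (fun y => absorbedWildCount_le_priced_add ρ₁ δ y) h

/-! ## §4  Counting: the cover (excluded middle four times, plus depth) and the weaker side -/

/-- **COVER**: `#wild ≤ #absorbed + #mildShear + #halo + #strainCore + #roughCore + #{not L-deep}`. [this file] -/
theorem wildRunCount_le_cells (ρ₁ L θ₁ : ℝ) (y : Fin N → EuclideanSpace ℝ (Fin 3)) :
    wildRunCount 64 ρ₁ (1 / 10 ^ 4) (1 / 1000) (3 / 50) (1 / 450) 12 2 y ≤
      absorbedWildCount ρ₁ y + mildShearCount ρ₁ L θ₁ y + haloWildCount ρ₁ L θ₁ y + strainCoreCount ρ₁ L θ₁ y + roughCoreCount ρ₁ L θ₁ y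
        + notDeepCount L (3 / 50) (1 / 450) y := by
  have s0 : wildRunCount 64 ρ₁ (1 / 10 ^ 4) (1 / 1000) (3 / 50) (1 / 450) 12 2 y ≤
      notDeepCount L (3 / 50) (1 / 450) y + Nat.card {j : Fin N // WildSite ρ₁ y j ∧ DeepReg L (3 / 50) (1 / 450) y j} := by
    rw [wildRunCount_eq]
    exact natCard_le_add_of_imp fun j hj => by
      by_cases hD : DeepReg L (3 / 50) (1 / 450) y j
      · exact Or.inr ⟨hj, hD⟩
      · exact Or.inl hD
  have s1 : Nat.card {j : Fin N // WildSite ρ₁ y j ∧ DeepReg L (3 / 50) (1 / 450) y j} ≤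
      absorbedWildCount ρ₁ y + Nat.card {j : Fin N // WildSite ρ₁ y j ∧ (DeepReg L (3 / 50) (1 / 450) y j ∧ ¬ Absorbable y j)} :=
    natCard_le_add_of_imp fun j hj => by
      by_cases hA : Absorbable y j
      · exact Or.inl ⟨hj.1, hA⟩
      · exact Or.inr ⟨hj.1, hj.2, hA⟩
  have s2 : Nat.card {j : Fin N // WildSite ρ₁ y j ∧ (DeepReg L (3 / 50) (1 / 450) y j ∧ ¬ Absorbable y j)} ≤
      mildShearCount ρ₁ L θ₁ y + Nat.card {j : Fin N // WildSite ρ₁ y j ∧ (DeepReg L (3 / 50) (1 / 450) y j ∧ ¬ Absorbable y j) ∧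
        ¬ AffDeepReg ρ₁ (1 / 10 ^ 4) θ₁ (1 / 450) y j} :=
    natCard_le_add_of_imp fun j hj => by
      by_cases hM : AffDeepReg ρ₁ (1 / 10 ^ 4) θ₁ (1 / 450) y j
      · exact Or.inl ⟨hj.1, hj.2, hM⟩
      · exact Or.inr ⟨hj.1, hj.2, hM⟩
  have s3 : Nat.card {j : Fin N // WildSite ρ₁ y j ∧ (DeepReg L (3 / 50) (1 / 450) y j ∧ ¬ Absorbable y j) ∧
        ¬ AffDeepReg ρ₁ (1 / 10 ^ 4) θ₁ (1 / 450) y j} ≤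
      haloWildCount ρ₁ L θ₁ y + Nat.card {j : Fin N // WildSite ρ₁ y j ∧ (DeepReg L (3 / 50) (1 / 450) y j ∧ ¬ Absorbable y j) ∧
        ¬ AffDeepReg ρ₁ (1 / 10 ^ 4) θ₁ (1 / 450) y j ∧ ¬ AffDeepReg 12 (1 / 10 ^ 4) (1 / 1000) (1 / 450) y j} :=
    natCard_le_add_of_imp fun j hj => by
      by_cases hH : AffDeepReg 12 (1 / 10 ^ 4) (1 / 1000) (1 / 450) y j
      · exact Or.inl ⟨hj.1, hj.2.1, hj.2.2, hH⟩
      · exact Or.inr ⟨hj.1, hj.2.1, hj.2.2, hH⟩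
  have s4 : Nat.card {j : Fin N // WildSite ρ₁ y j ∧ (DeepReg L (3 / 50) (1 / 450) y j ∧ ¬ Absorbable y j) ∧
        ¬ AffDeepReg ρ₁ (1 / 10 ^ 4) θ₁ (1 / 450) y j ∧ ¬ AffDeepReg 12 (1 / 10 ^ 4) (1 / 1000) (1 / 450) y j} ≤
      strainCoreCount ρ₁ L θ₁ y + roughCoreCount ρ₁ L θ₁ y :=
    natCard_le_add_of_imp fun j hj => by
      by_cases hG : AffDeepReg 12 (1 / 10 ^ 4) (1 / 25) (1 / 450) y j
      · exact Or.inl ⟨hj.1, hj.2.1, hj.2.2.1, hj.2.2.2, hG⟩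
      · exact Or.inr ⟨hj.1, hj.2.1, hj.2.2.1, hG⟩
  omega

/-- **COVER AT TOLERANCE `θ₁ ≥ 10⁻³`**: `#wild(ρ₁, θ₁) ≤ #absorbed + #halo + #strainCore + #roughCore + #{not L-deep}` — a site wild at the looser tolerance
is wild (`affDeepReg_mono_theta` BY NAME) and is never «MildShear». [this file] -/
theorem wildRunCount_tol_le_cells {ρ₁ L θ₁ : ℝ} (hθ : (1 / 1000 : ℝ) ≤ θ₁) (y : Fin N → EuclideanSpace ℝ (Fin 3)) :
    wildRunCount 64 ρ₁ (1 / 10 ^ 4) θ₁ (3 / 50) (1 / 450) 12 2 y ≤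
      absorbedWildCount ρ₁ y + haloWildCount ρ₁ L θ₁ y + strainCoreCount ρ₁ L θ₁ y + roughCoreCount ρ₁ L θ₁ y
        + notDeepCount L (3 / 50) (1 / 450) y := by
  have s0 : wildRunCount 64 ρ₁ (1 / 10 ^ 4) θ₁ (3 / 50) (1 / 450) 12 2 y ≤
      notDeepCount L (3 / 50) (1 / 450) y + Nat.card {j : Fin N // (WildSite ρ₁ y j ∧ DeepReg L (3 / 50) (1 / 450) y j) ∧
        ¬ AffDeepReg ρ₁ (1 / 10 ^ 4) θ₁ (1 / 450) y j} :=
    natCard_le_add_of_imp fun j hj => by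
      by_cases hD : DeepReg L (3 / 50) (1 / 450) y j
      · exact Or.inr ⟨⟨⟨hj.1, fun hA => hj.2 (affDeepReg_mono_theta hθ hA)⟩, hD⟩, hj.2⟩
      · exact Or.inl hD
  have s1 : Nat.card {j : Fin N // (WildSite ρ₁ y j ∧ DeepReg L (3 / 50) (1 / 450) y j) ∧ ¬ AffDeepReg ρ₁ (1 / 10 ^ 4) θ₁ (1 / 450) y j} ≤
      absorbedWildCount ρ₁ y + Nat.card {j : Fin N // WildSite ρ₁ y j ∧ (DeepReg L (3 / 50) (1 / 450) y j ∧ ¬ Absorbable y j) ∧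
        ¬ AffDeepReg ρ₁ (1 / 10 ^ 4) θ₁ (1 / 450) y j} :=
    natCard_le_add_of_imp fun j hj => by
      by_cases hA : Absorbable y j
      · exact Or.inl ⟨hj.1.1, hA⟩
      · exact Or.inr ⟨hj.1.1, ⟨hj.1.2, hA⟩, hj.2⟩
  have s3 : Nat.card {j : Fin N // WildSite ρ₁ y j ∧ (DeepReg L (3 / 50) (1 / 450) y j ∧ ¬ Absorbable y j) ∧
        ¬ AffDeepReg ρ₁ (1 / 10 ^ 4) θ₁ (1 / 450) y j} ≤
      haloWildCount ρ₁ L θ₁ y + Nat.card {j : Fin N // WildSite ρ₁ y j ∧ (DeepReg L (3 / 50) (1 / 450) y j ∧ ¬ Absorbable y j) ∧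
        ¬ AffDeepReg ρ₁ (1 / 10 ^ 4) θ₁ (1 / 450) y j ∧ ¬ AffDeepReg 12 (1 / 10 ^ 4) (1 / 1000) (1 / 450) y j} :=
    natCard_le_add_of_imp fun j hj => by
      by_cases hH : AffDeepReg 12 (1 / 10 ^ 4) (1 / 1000) (1 / 450) y j
      · exact Or.inl ⟨hj.1, hj.2.1, hj.2.2, hH⟩
      · exact Or.inr ⟨hj.1, hj.2.1, hj.2.2, hH⟩
  have s4 : Nat.card {j : Fin N // WildSite ρ₁ y j ∧ (DeepReg L (3 / 50) (1 / 450) y j ∧ ¬ Absorbable y j) ∧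
        ¬ AffDeepReg ρ₁ (1 / 10 ^ 4) θ₁ (1 / 450) y j ∧ ¬ AffDeepReg 12 (1 / 10 ^ 4) (1 / 1000) (1 / 450) y j} ≤
      strainCoreCount ρ₁ L θ₁ y + roughCoreCount ρ₁ L θ₁ y :=
    natCard_le_add_of_imp fun j hj => by
      by_cases hG : AffDeepReg 12 (1 / 10 ^ 4) (1 / 25) (1 / 450) y j
      · exact Or.inl ⟨hj.1, hj.2.1, hj.2.2.1, hj.2.2.2, hG⟩
      · exact Or.inr ⟨hj.1, hj.2.1, hj.2.2.1, hG⟩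
  omega

/-- Weaker side: every cell counts a subset of the wild sites. [this file] -/
theorem absorbedWildCount_le (ρ₁ : ℝ) (y : Fin N → EuclideanSpace ℝ (Fin 3)) :
    absorbedWildCount ρ₁ y ≤ wildRunCount 64 ρ₁ (1 / 10 ^ 4) (1 / 1000) (3 / 50) (1 / 450) 12 2 y := by
  rw [wildRunCount_eq]; exact natCard_le_of_imp fun _ hj => hj.1

/-- `#mildShear ≤ #wild`. [this file] -/
theorem mildShearCount_le (ρ₁ L θ₁ : ℝ) (y : Fin N → EuclideanSpace ℝ (Fin 3)) :
    mildShearCount ρ₁ L θ₁ y ≤ wildRunCount 64 ρ₁ (1 / 10 ^ 4) (1 / 1000) (3 / 50) (1 / 450) 12 2 y := by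
  rw [wildRunCount_eq]; exact natCard_le_of_imp fun _ hj => hj.1

/-- `#halo ≤ #wild`. [this file] -/
theorem haloWildCount_le (ρ₁ L θ₁ : ℝ) (y : Fin N → EuclideanSpace ℝ (Fin 3)) :
    haloWildCount ρ₁ L θ₁ y ≤ wildRunCount 64 ρ₁ (1 / 10 ^ 4) (1 / 1000) (3 / 50) (1 / 450) 12 2 y := by
  rw [wildRunCount_eq]; exact natCard_le_of_imp fun _ hj => hj.1

/-- `#strainCore ≤ #wild`. [this file] -/
theorem strainCoreCount_le (ρ₁ L θ₁ : ℝ) (y : Fin N → EuclideanSpace ℝ (Fin 3)) :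
    strainCoreCount ρ₁ L θ₁ y ≤ wildRunCount 64 ρ₁ (1 / 10 ^ 4) (1 / 1000) (3 / 50) (1 / 450) 12 2 y := by
  rw [wildRunCount_eq]; exact natCard_le_of_imp fun _ hj => hj.1

/-- `#roughCore ≤ #wild`. [this file] -/
theorem roughCoreCount_le (ρ₁ L θ₁ : ℝ) (y : Fin N → EuclideanSpace ℝ (Fin 3)) :
    roughCoreCount ρ₁ L θ₁ y ≤ wildRunCount 64 ρ₁ (1 / 10 ^ 4) (1 / 1000) (3 / 50) (1 / 450) 12 2 y := by
  rw [wildRunCount_eq]; exact natCard_le_of_imp fun _ hj => hj.1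

/-- `#halo ≤ #wild(ρ₁, θ₁)` (wild even at the looser tolerance). [this file] -/
theorem haloWildCount_le_tol (ρ₁ L θ₁ : ℝ) (y : Fin N → EuclideanSpace ℝ (Fin 3)) :
    haloWildCount ρ₁ L θ₁ y ≤ wildRunCount 64 ρ₁ (1 / 10 ^ 4) θ₁ (3 / 50) (1 / 450) 12 2 y :=
  natCard_le_of_imp fun _ hj => ⟨hj.1.1, hj.2.2.1⟩

/-- `#strainCore ≤ #wild(ρ₁, θ₁)`. [this file] -/
theorem strainCoreCount_le_tol (ρ₁ L θ₁ : ℝ) (y : Fin N → EuclideanSpace ℝ (Fin 3)) :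
    strainCoreCount ρ₁ L θ₁ y ≤ wildRunCount 64 ρ₁ (1 / 10 ^ 4) θ₁ (3 / 50) (1 / 450) 12 2 y :=
  natCard_le_of_imp fun _ hj => ⟨hj.1.1, hj.2.2.1⟩

/-- `#roughCore ≤ #wild(ρ₁, θ₁)`. [this file] -/
theorem roughCoreCount_le_tol (ρ₁ L θ₁ : ℝ) (y : Fin N → EuclideanSpace ℝ (Fin 3)) :
    roughCoreCount ρ₁ L θ₁ y ≤ wildRunCount 64 ρ₁ (1 / 10 ^ 4) θ₁ (3 / 50) (1 / 450) 12 2 y :=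
  natCard_le_of_imp fun _ hj => ⟨hj.1.1, hj.2.2.1⟩

/-- Tolerance anti-monotonicity of the wild count: `1/1000 ≤ θ₁ ⇒ #wild(ρ₁, θ₁) ≤ #wild(ρ₁, 1/1000)`. [this file] -/
theorem wildRunCount_anti_tol {ρ₁ θ₁ : ℝ} (hθ : (1 / 1000 : ℝ) ≤ θ₁) (y : Fin N → EuclideanSpace ℝ (Fin 3)) :
    wildRunCount 64 ρ₁ (1 / 10 ^ 4) θ₁ (3 / 50) (1 / 450) 12 2 y ≤ wildRunCount 64 ρ₁ (1 / 10 ^ 4) (1 / 1000) (3 / 50) (1 / 450) 12 2 y :=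
  natCard_le_of_imp fun _ hj => ⟨hj.1, fun hA => hj.2 (affDeepReg_mono_theta hθ hA)⟩

/-- `#halo ≤ #rigidRun(12)`: a halo site is a rigid run interior of the radius-`12` swap (`17/20 ≤ nn` from non-absorbability). [this file] -/
theorem haloWildCount_le_rigidRun (ρ₁ L θ₁ : ℝ) (y : Fin N → EuclideanSpace ℝ (Fin 3)) :
    haloWildCount ρ₁ L θ₁ y ≤ rigidRunCount 64 12 (1 / 10 ^ 4) (1 / 1000) (17 / 20) (3 / 50) (1 / 450) 12 2 y :=
  natCard_le_of_imp fun j hj => ⟨hj.1.1, hj.2.2.2, by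
    have hA : ¬ Absorbable y j := hj.2.1.2
    unfold Absorbable at hA
    push Not at hA
    exact hA.2 hj.2.2.2⟩

/-- At `ρ₁ = 12` the halo is EMPTY (rigid and wild at the same radius is absurd). [this file] -/
theorem haloWildCount_twelve (L θ₁ : ℝ) (y : Fin N → EuclideanSpace ℝ (Fin 3)) : haloWildCount 12 L θ₁ y = 0 := by
  unfold haloWildCount
  rw [Nat.card_eq_zero]
  exact Or.inl ⟨fun j => j.2.1.2 j.2.2.2.2⟩

end Summit.AtomisticToContinuum.Crystallization.Theorems.OverbindingBudgetAffineWildCut
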